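import Summits.CriticalPhenomena.SAWScalingLimit.Theorems.SAWChargeContinuationAnchorExcursionWindowDecomposition
import Summits.CriticalPhenomena.SAWScalingLimit.Theorems.SAWLoopFugacityFlowAvoidanceLimitSphereRatioLimitAssembly
import Summits.CriticalPhenomena.SAWScalingLimit.Theorems.SAWLoopFugacityFlowAvoidanceLimitLatticeTopology

/-!
# `AnchorExcursion` (stmt-CriticalPhenomena-11196) reduced to the two printed lattice inputs:
# the uniform discrete boundary Harnack principle at the marked prime ends and the interior
# convergence of killed-SRW Green's functions — for the item's WINDOW graph

Route `SAWChargeContinuation` of `CriticalPhenomena/SAWScalingLimit`, support item `AnchorExcursion`: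
`G_{W_δ}(a_δ, b_δ)/G_{D_δ}(a_δ, b_δ) → d = Φ'_A(0)` along every endpoint approximation, for every
hull subdomain `D'` with restriction data `(φ, Φ, d)` (`W_δ` = the item's window graph; companion
file `…AnchorExcursionWindowDecomposition` for its lattice machinery).

The sibling crux `SAWLoopFugacityFlow.AvoidanceLimit` (stmt-CriticalPhenomena-10649, line
`symplectic-fermion-anchor`) isolated, for its CONFINED-graph version of the same statement (stub S3
`ExcursionRatio`), the missing inputs as (TOP) lattice topology of Jordan domains — PROVED there,
`stub_latticeTopology` —, (BHP) the uniform discrete boundary Harnack principle at `a`, `b`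
(Chelkak–Wan 2021, Lemma 3.7 / Cor. 3.8) and (INT) interior convergence of the killed Green's
functions (ibid. Prop. 3.2 / Cor. 3.3; Chelkak–Smirnov 2011). This file proves the SAME reduction
for the item:

* §3 `anchorExcursion_of_tendsto_windowRatio` — the item from the Green's-ratio limit at the legs
  (lattice identity `Z(D_δ|·; 1, 1/4) = rwGreen`, `greenEntry = rwGreen.toReal` on the volume);
  `anchorExcursion_of_windowSphereRatioLimit` — the item from the UNIFORM sphere form of the ratio
  limit (window twin of stub S3b `stub_sphereRatioLimit`; no endpoint approximation is left in the
  hypothesis: two-sided exit decomposition `windowRatio_mem_of_sphere`);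
* §4 `windowSphereRatioLimit_of_oscillation_of_interiorLimit` and the closing reduction
  `anchorExcursion_of_oscillation_of_interiorLimit` — **`(BHP_W) → (INT_W) → AnchorExcursion`**
  (the sphere-form theorem is stated with (TOP) as an explicit hypothesis, discharged in the closing
  theorem by the sibling's landed `stub_latticeTopology`); (BHP_W), (INT_W) are the window-graph
  forms of (BHP) and (INT) (stated inline; they are the ONLY inputs of the item not in the tree, and
  they have the same shape as the sibling's, with `W_δ` for `confinedGraph`).

Sources: D. Chelkak, Y. Wan, Electron. J. Probab. 26 (2021), §3 [ChelkakWan2021]; D. Chelkak,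
Ann. Probab. 44 (2016) §2–3 [Chelkak2016]; G. F. Lawler, *Intersections of Random Walks* (1991)
§1.5 [Lawler1991]; LSW, *Conformal restriction: the chordal case* (2003) Prop. 4.1
[LawlerSchrammWerner2003Restriction]. No definitions, no named facts.
-/

noncomputable section

open scoped ENNReal Topology ComplexConjugate BigOperators Classical
open Filter Finset Literature.Probability.RandomPlanarGeometry Literature.Probability.LatticeModels
open Summit.CriticalPhenomena.SAWScalingLimit.Theses.SAWChargeContinuation
open Summit.CriticalPhenomena.SAWScalingLimit.Theorems.AvoidanceLimit.Anchor

namespace Summit.CriticalPhenomena.SAWScalingLimit.Theorems.AnchorExcursion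

/-! ## §3 The item from the Green's-ratio limit at the legs, and from the uniform sphere form -/

section Item

/-- **`AnchorExcursion` from the limit of the matrix Green's-function ratio at the legs.** If for all
hull data and every endpoint approximation `greenEntry W_δ Λ a_δ b_δ / greenEntry D_δ Λ a_δ b_δ → d`
(`Λ = meshDomainFinset D δ`), then the item holds: for `δ > 0` small both legs lie in `meshDomain D δ`
(`eventually_mem_meshDomain`), where `greenEntry = (rwGreen ·).toReal`
(`greenEntry_window_eq_toReal_rwGreen`, `greenEntry_domain_eq_toReal_rwGreen`), and the item's two
partition functions ARE these walk sums (`tsum_domainSAW_complex_eq`). [folklore] -/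
theorem anchorExcursion_of_tendsto_windowRatio
    (hX : ∀ (D D' : DobrushinDomain), D.IsHullSubdomain D' →
      ∀ (a b : ℝ → Site 2), SAW.IsEndpointApprox D a b →
      ∀ (φ : ConformalEquiv UpperHalfPlane.upperHalfPlaneSet D.carrier), D.IsChordalUniformizing φ →
      ∀ (Φ : ConformalEquiv (UpperHalfPlane.upperHalfPlaneSet \ φ.pullbackHull D')
        UpperHalfPlane.upperHalfPlaneSet) (d : ℝ), IsRestrictionMap (φ.pullbackHull D') Φ →
        HasRestrictionDeriv (φ.pullbackHull D') Φ d →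
      Tendsto (fun δ =>
        greenEntry (SimpleGraph.fromRel fun x y => (discreteDomainGraph D.carrier δ).Adj x y ∧
            (meshGraph D'.carrier δ).Adj x y ∧ x ∈ meshVertices D'.carrier δ ∧
            y ∈ meshVertices D'.carrier δ) (meshDomainFinset D.carrier δ) (a δ) (b δ) /
          greenEntry (discreteDomainGraph D.carrier δ) (meshDomainFinset D.carrier δ) (a δ) (b δ))
        (𝓝[>] 0) (𝓝 d)) :
    AnchorExcursion := by
  unfold AnchorExcursion
  intro hull pb G m Z D D' hDD' a b hab φ hφ Φ d hΦ hd
  have hhull : D.IsHullSubdomain D' := hDD'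
  have hpb : pb D φ D' = φ.pullbackHull D' := rfl
  have hlim := hX D D' hhull a b hab φ hφ Φ d hΦ hd
  -- rewrite the matrix Green's functions as walk sums, eventually
  have hreal : Tendsto (fun δ => (rwGreen (G D.carrier D'.carrier δ) (a δ) (b δ)).toReal /
      (rwGreen (discreteDomainGraph D.carrier δ) (a δ) (b δ)).toReal) (𝓝[>] 0) (𝓝 d) := by
    refine hlim.congr' ?_
    filter_upwards [self_mem_nhdsWithin, AvoidanceLimit.Anchor.eventually_mem_meshDomain hab]
      with δ hδ hmem
    have hδ' : (0 : ℝ) < δ := hδ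
    simp only [G]
    rw [greenEntry_window_eq_toReal_rwGreen D.isBounded hδ' hmem.2.1 hmem.2.2,
      greenEntry_domain_eq_toReal_rwGreen D.isBounded hδ' hmem.2.1 hmem.2.2]
  -- and the item's quotient is that ratio for `δ > 0`
  refine ((Complex.continuous_ofReal.tendsto d).comp hreal).congr' ?_
  filter_upwards [self_mem_nhdsWithin] with δ hδ
  have hδ' : (0 : ℝ) < δ := hδ
  simp only [Z, m, Function.comp_apply]
  rw [Complex.ofReal_div]
  congr 1
  · exact (tsum_domainSAW_complex_eq (windowGraph_le D.carrier D'.carrier δ)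
      (edgeSet_finite_of_le (windowGraph_le D.carrier D'.carrier δ) D.isBounded hδ')
      (a δ) (b δ) _ _).symm
  · conv_lhs => rw [← windowGraph_self_eq D.carrier δ]
    exact (tsum_domainSAW_complex_eq (windowGraph_le D.carrier D.carrier δ)
      (edgeSet_finite_of_le (windowGraph_le D.carrier D.carrier δ) D.isBounded hδ')
      (a δ) (b δ) _ _).symm

/-- **`AnchorExcursion` from the UNIFORM sphere form of the window-ratio limit** (the window-graph
twin of the sibling stub `stub_sphereRatioLimit` of crux 10649): if for all hull data (stated, as
there, through ball agreement at the marked points and `A = cl(ℍ ∖ φ⁻¹ D')`) and every `η > 0` there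
is `r₀ > 0` such that for every radius `r ∈ (0, r₀)`, for all small `δ`, at every pair `(z, y)` of the
two lattice exit spheres with `G_{D_δ}(z, y) > 0` the window ratio `G_W(z,y)/G_{D_δ}(z,y)` is within `η`
of `d`, then the item holds. No endpoint approximation is left in the hypothesis: given `η`, take
`r = min (r₀/2) (min (ε/4) (|a − b|/8))`; for small `δ` the legs are within `r` of the marked points,
the denominator is positive (`eventually_greenEntry_pos`) and the sphere bound transfers to the legs by
`windowRatio_mem_of_sphere`. A hull subdomain agrees with the domain on balls about the marked points
(`exists_ball_inter_eq`). [folklore] -/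
theorem anchorExcursion_of_windowSphereRatioLimit
    (hS : ∀ (D D' : DobrushinDomain), D'.carrier ⊆ D.carrier → D'.pt 0 = D.pt 0 → D'.pt 1 = D.pt 1 →
      (∃ ε : ℝ, 0 < ε ∧ D'.carrier ∩ Metric.ball (D.pt 0) ε = D.carrier ∩ Metric.ball (D.pt 0) ε ∧
        D'.carrier ∩ Metric.ball (D.pt 1) ε = D.carrier ∩ Metric.ball (D.pt 1) ε) →
      ∀ (φ : ConformalEquiv UpperHalfPlane.upperHalfPlaneSet D.carrier), D.IsChordalUniformizing φ →
      ∀ (A : Set ℂ), A = closure (UpperHalfPlane.upperHalfPlaneSet \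
        {z | z ∈ UpperHalfPlane.upperHalfPlaneSet ∧ φ z ∈ D'.carrier}) →
      ∀ (Φ : ConformalEquiv (UpperHalfPlane.upperHalfPlaneSet \ A) UpperHalfPlane.upperHalfPlaneSet)
        (d : ℝ), IsRestrictionMap A Φ → HasRestrictionDeriv A Φ d →
      ∀ η : ℝ, 0 < η → ∃ r₀ : ℝ, 0 < r₀ ∧ ∀ r ∈ Set.Ioo (0 : ℝ) r₀, ∀ᶠ δ in 𝓝[>] (0 : ℝ),
        ∀ z y : Site 2, r ≤ dist (meshPoint δ z) (D.pt 0) → dist (meshPoint δ z) (D.pt 0) < r + δ →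
          r ≤ dist (meshPoint δ y) (D.pt 1) → dist (meshPoint δ y) (D.pt 1) < r + δ →
          0 < greenEntry (discreteDomainGraph D.carrier δ) (meshDomainFinset D.carrier δ) z y →
          |greenEntry (SimpleGraph.fromRel fun x y => (discreteDomainGraph D.carrier δ).Adj x y ∧
                (meshGraph D'.carrier δ).Adj x y ∧ x ∈ meshVertices D'.carrier δ ∧
                y ∈ meshVertices D'.carrier δ) (meshDomainFinset D.carrier δ) z y /
              greenEntry (discreteDomainGraph D.carrier δ) (meshDomainFinset D.carrier δ) z y - d| ≤ η) :
    AnchorExcursion := by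
  refine anchorExcursion_of_tendsto_windowRatio fun D D' hhull a b hab φ hφ Φ d hΦ hd => ?_
  obtain ⟨ε, hε, hb0, hb1⟩ := exists_ball_inter_eq hhull
  rw [Metric.tendsto_nhds]
  intro η hη
  obtain ⟨r₀, hr₀, hr⟩ := hS D D' hhull.carrier_subset hhull.pt_zero_eq hhull.pt_one_eq
    ⟨ε, hε, hb0, hb1⟩ φ hφ (φ.pullbackHull D') rfl Φ d hΦ hd (η / 2) (by positivity)
  have hpq : D.pt 0 ≠ D.pt 1 := fun h => absurd (D.pt_injective h) (by decide)
  have hdist : 0 < dist (D.pt 0) (D.pt 1) := dist_pos.2 hpq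
  set r : ℝ := min (r₀ / 2) (min (ε / 4) (dist (D.pt 0) (D.pt 1) / 8)) with hr_def
  have hrpos : 0 < r := by
    simp only [hr_def, lt_min_iff]
    exact ⟨by positivity, by positivity, by positivity⟩
  have hr1 : r < r₀ := lt_of_le_of_lt (min_le_left _ _) (by linarith)
  have hr2 : r ≤ ε / 4 := (min_le_right _ _).trans (min_le_left _ _)
  have hr3 : r ≤ dist (D.pt 0) (D.pt 1) / 8 := (min_le_right _ _).trans (min_le_right _ _)
  have hSr := hr r ⟨hrpos, hr1⟩
  have hδ : ∀ᶠ δ in 𝓝[>] (0 : ℝ), δ ∈ Set.Ioo (0 : ℝ) r := Ioo_mem_nhdsGT hrpos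
  have hδa : ∀ᶠ δ in 𝓝[>] (0 : ℝ), dist (meshPoint δ (a δ)) (D.pt 0) < r :=
    (Metric.tendsto_nhds.1 hab.tendsto_fst) r hrpos
  have hδb : ∀ᶠ δ in 𝓝[>] (0 : ℝ), dist (meshPoint δ (b δ)) (D.pt 1) < r :=
    (Metric.tendsto_nhds.1 hab.tendsto_snd) r hrpos
  filter_upwards [hSr, hδ, hδa, hδb, eventually_greenEntry_pos hab] with δ hSδ hδr hδa' hδb' hpos
  have hbound := windowRatio_mem_of_sphere D.carrier D'.carrier (D.pt 0) (D.pt 1) ε r δ (a δ) (b δ)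
    (d - η / 2) (d + η / 2) hδr.1 hrpos (by linarith [hδr.2]) hb0 hb1 (by linarith [hδr.2]) hδa' hδb'
    hpos (fun z y hz1 hz2 hy1 hy2 hzy => by
      have h := abs_le.1 (hSδ z y hz1 hz2 hy1 hy2 hzy)
      constructor <;> linarith [h.1, h.2])
  rw [Real.dist_eq, abs_lt]
  constructor <;> linarith [hbound.1, hbound.2]

end Item

/-! ## §4 The sphere form from (BHP_W) + (INT_W); the closing reduction -/

section Assembly

/-- **The uniform sphere form of the window-ratio limit from (BHP_W) + (INT_W)** — window-graph twin
of the sibling line's `stub_sphereRatioLimit_of_oscillation_of_interiorLimit` (crux 10649). The three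
hypotheses, in this order: (TOP) interior points of a Dobrushin domain are eventually approximated by
lattice points joined in `D_δ` inside the volume — LANDED verbatim as the sibling's
`stub_latticeTopology` (file `…AvoidanceLimitLatticeTopology`), kept as an explicit hypothesis of
this general statement and discharged in the closing theorem below; (BHP_W) the oscillation of the window ratio `F_δ = G_W/G_{D_δ}` over `B(a,r) × B(b,r)` tends to `0`
with `r`, uniformly in small `δ` — the uniform discrete boundary Harnack principle of Chelkak–Wan
(Lemma 3.7 / Cor. 3.8) at the two marked prime ends, applied to `G_W(·, y)`, `G_{D_δ}(·, y)`, which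
are harmonic for the SAME walk inside the agreement balls (`windowGraph_adj_iff_of_dist_lt`);
(INT_W) at distinct interior reference points `z*, y* ∈ D'`, `F_δ(u, v) → ρ(z*, y*) =
G_{D'}(z*,y*)/G_D(z*,y*)` as `(δu, δv) → (z*, y*)`, `δ → 0` — interior convergence of the killed
Green's functions (ibid. Cor. 3.3; Chelkak–Smirnov 2011) and conformal invariance. Conclusion: the
hypothesis of `anchorExcursion_of_windowSphereRatioLimit`, via the landed continuum half
`greenRatioCont_near_pts` and two triangle inequalities (`η/3` each).
[cite: ChelkakWan2021, Lemma 3.7 and Corollary 3.8 (§3.2); Corollary 3.3 (§3.1)] -/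
theorem windowSphereRatioLimit_of_oscillation_of_interiorLimit
    (hT : ∀ (D : DobrushinDomain) (zs ys : ℂ), zs ∈ D.carrier → ys ∈ D.carrier → ∀ s : ℝ, 0 < s →
      ∀ᶠ δ in 𝓝[>] (0 : ℝ), ∃ u v : Site 2, dist (meshPoint δ u) zs < s ∧ dist (meshPoint δ v) ys < s ∧
        0 < greenEntry (discreteDomainGraph D.carrier δ) (meshDomainFinset D.carrier δ) u v)
    (hB : ∀ (D D' : DobrushinDomain), D'.carrier ⊆ D.carrier → D'.pt 0 = D.pt 0 → D'.pt 1 = D.pt 1 →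
      (∃ ε : ℝ, 0 < ε ∧ D'.carrier ∩ Metric.ball (D.pt 0) ε = D.carrier ∩ Metric.ball (D.pt 0) ε ∧
        D'.carrier ∩ Metric.ball (D.pt 1) ε = D.carrier ∩ Metric.ball (D.pt 1) ε) →
      ∀ η : ℝ, 0 < η → ∃ r : ℝ, 0 < r ∧ ∀ᶠ δ in 𝓝[>] (0 : ℝ), ∀ z z' y y' : Site 2,
        dist (meshPoint δ z) (D.pt 0) < r → dist (meshPoint δ z') (D.pt 0) < r →
        dist (meshPoint δ y) (D.pt 1) < r → dist (meshPoint δ y') (D.pt 1) < r →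
        0 < greenEntry (discreteDomainGraph D.carrier δ) (meshDomainFinset D.carrier δ) z y →
        0 < greenEntry (discreteDomainGraph D.carrier δ) (meshDomainFinset D.carrier δ) z' y' →
        |greenEntry (SimpleGraph.fromRel fun x y => (discreteDomainGraph D.carrier δ).Adj x y ∧
                (meshGraph D'.carrier δ).Adj x y ∧ x ∈ meshVertices D'.carrier δ ∧
                y ∈ meshVertices D'.carrier δ) (meshDomainFinset D.carrier δ) z y /
              greenEntry (discreteDomainGraph D.carrier δ) (meshDomainFinset D.carrier δ) z y -
            greenEntry (SimpleGraph.fromRel fun x y => (discreteDomainGraph D.carrier δ).Adj x y ∧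
                (meshGraph D'.carrier δ).Adj x y ∧ x ∈ meshVertices D'.carrier δ ∧
                y ∈ meshVertices D'.carrier δ) (meshDomainFinset D.carrier δ) z' y' /
              greenEntry (discreteDomainGraph D.carrier δ) (meshDomainFinset D.carrier δ) z' y'| ≤ η)
    (hI : ∀ (D D' : DobrushinDomain), D'.carrier ⊆ D.carrier → D'.pt 0 = D.pt 0 → D'.pt 1 = D.pt 1 →
      (∃ ε : ℝ, 0 < ε ∧ D'.carrier ∩ Metric.ball (D.pt 0) ε = D.carrier ∩ Metric.ball (D.pt 0) ε ∧
        D'.carrier ∩ Metric.ball (D.pt 1) ε = D.carrier ∩ Metric.ball (D.pt 1) ε) →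
      ∀ (φ : ConformalEquiv UpperHalfPlane.upperHalfPlaneSet D.carrier), D.IsChordalUniformizing φ →
      ∀ (A : Set ℂ), A = closure (UpperHalfPlane.upperHalfPlaneSet \
        {z | z ∈ UpperHalfPlane.upperHalfPlaneSet ∧ φ z ∈ D'.carrier}) →
      ∀ (Φ : ConformalEquiv (UpperHalfPlane.upperHalfPlaneSet \ A) UpperHalfPlane.upperHalfPlaneSet),
        IsRestrictionMap A Φ →
      ∀ zs ys : ℂ, zs ∈ D'.carrier → ys ∈ D'.carrier → zs ≠ ys →
      ∀ η : ℝ, 0 < η → ∃ s : ℝ, 0 < s ∧ ∀ᶠ δ in 𝓝[>] (0 : ℝ), ∀ u v : Site 2,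
        dist (meshPoint δ u) zs < s → dist (meshPoint δ v) ys < s →
        0 < greenEntry (discreteDomainGraph D.carrier δ) (meshDomainFinset D.carrier δ) u v →
        |greenEntry (SimpleGraph.fromRel fun x y => (discreteDomainGraph D.carrier δ).Adj x y ∧
                (meshGraph D'.carrier δ).Adj x y ∧ x ∈ meshVertices D'.carrier δ ∧
                y ∈ meshVertices D'.carrier δ) (meshDomainFinset D.carrier δ) u v /
              greenEntry (discreteDomainGraph D.carrier δ) (meshDomainFinset D.carrier δ) u v -
            Real.log (‖Φ (φ.symm zs) - (starRingEnd ℂ) (Φ (φ.symm ys))‖ / ‖Φ (φ.symm zs) - Φ (φ.symm ys)‖) /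
              Real.log (‖φ.symm zs - (starRingEnd ℂ) (φ.symm ys)‖ / ‖φ.symm zs - φ.symm ys‖)| ≤ η) :
    ∀ (D D' : DobrushinDomain), D'.carrier ⊆ D.carrier → D'.pt 0 = D.pt 0 → D'.pt 1 = D.pt 1 →
      (∃ ε : ℝ, 0 < ε ∧ D'.carrier ∩ Metric.ball (D.pt 0) ε = D.carrier ∩ Metric.ball (D.pt 0) ε ∧
        D'.carrier ∩ Metric.ball (D.pt 1) ε = D.carrier ∩ Metric.ball (D.pt 1) ε) →
      ∀ (φ : ConformalEquiv UpperHalfPlane.upperHalfPlaneSet D.carrier), D.IsChordalUniformizing φ →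
      ∀ (A : Set ℂ), A = closure (UpperHalfPlane.upperHalfPlaneSet \
        {z | z ∈ UpperHalfPlane.upperHalfPlaneSet ∧ φ z ∈ D'.carrier}) →
      ∀ (Φ : ConformalEquiv (UpperHalfPlane.upperHalfPlaneSet \ A) UpperHalfPlane.upperHalfPlaneSet)
        (d : ℝ), IsRestrictionMap A Φ → HasRestrictionDeriv A Φ d →
      ∀ η : ℝ, 0 < η → ∃ r₀ : ℝ, 0 < r₀ ∧ ∀ r ∈ Set.Ioo (0 : ℝ) r₀, ∀ᶠ δ in 𝓝[>] (0 : ℝ),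
        ∀ z y : Site 2, r ≤ dist (meshPoint δ z) (D.pt 0) → dist (meshPoint δ z) (D.pt 0) < r + δ →
          r ≤ dist (meshPoint δ y) (D.pt 1) → dist (meshPoint δ y) (D.pt 1) < r + δ →
          0 < greenEntry (discreteDomainGraph D.carrier δ) (meshDomainFinset D.carrier δ) z y →
          |greenEntry (SimpleGraph.fromRel fun x y => (discreteDomainGraph D.carrier δ).Adj x y ∧
                (meshGraph D'.carrier δ).Adj x y ∧ x ∈ meshVertices D'.carrier δ ∧
                y ∈ meshVertices D'.carrier δ) (meshDomainFinset D.carrier δ) z y /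
              greenEntry (discreteDomainGraph D.carrier δ) (meshDomainFinset D.carrier δ) z y - d| ≤ η := by
  intro D D' hsub h0 h1 hball φ hφ A hA Φ d hΦ hd η hη
  obtain ⟨ε, hε, hb0, hb1⟩ := hball
  -- the continuum half (i) and the oscillation bound (BHP_W), both at `η/3`
  obtain ⟨r₂, hr₂, hcont⟩ := greenRatioCont_near_pts D D' hsub h0 h1 ⟨ε, hε, hb0, hb1⟩ φ hφ A hA
    Φ d hΦ hd (η / 3) (by positivity)
  obtain ⟨r', hr', hbhp⟩ := hB D D' hsub h0 h1 ⟨ε, hε, hb0, hb1⟩ (η / 3) (by positivity)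
  -- the radius `r₀`
  have hab : 0 < dist (D.pt 0) (D.pt 1) :=
    dist_pos.2 fun h => absurd (D.pt_injective h) (by decide)
  set r₀ : ℝ := min (min r' r₂) (min ε (dist (D.pt 0) (D.pt 1))) / 4 with hr₀_def
  have hr₀ : 0 < r₀ := by positivity
  have h4r' : 4 * r₀ ≤ r' := by
    have : min (min r' r₂) (min ε (dist (D.pt 0) (D.pt 1))) ≤ r' :=
      (min_le_left _ _).trans (min_le_left _ _)
    simp only [hr₀_def]; linarith
  have h4r₂ : 4 * r₀ ≤ r₂ := by
    have : min (min r' r₂) (min ε (dist (D.pt 0) (D.pt 1))) ≤ r₂ :=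
      (min_le_left _ _).trans (min_le_right _ _)
    simp only [hr₀_def]; linarith
  have h4ε : 4 * r₀ ≤ ε := by
    have : min (min r' r₂) (min ε (dist (D.pt 0) (D.pt 1))) ≤ ε :=
      (min_le_right _ _).trans (min_le_left _ _)
    simp only [hr₀_def]; linarith
  have h4ab : 4 * r₀ ≤ dist (D.pt 0) (D.pt 1) := by
    have : min (min r' r₂) (min ε (dist (D.pt 0) (D.pt 1))) ≤ dist (D.pt 0) (D.pt 1) :=
      (min_le_right _ _).trans (min_le_right _ _)
    simp only [hr₀_def]; linarith
  -- interior reference points `zs ∈ D' ∩ B(a, r₀)`, `ys ∈ D' ∩ B(b, r₀)`, distinct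
  obtain ⟨zs, hzsD, hzs⟩ := exists_mem_carrier_dist_pt_lt D 0 hr₀
  obtain ⟨ys, hysD, hys⟩ := exists_mem_carrier_dist_pt_lt D 1 hr₀
  have hzsD' : zs ∈ D'.carrier := mem_carrier_of_ball hb0 hzsD (by linarith)
  have hysD' : ys ∈ D'.carrier := mem_carrier_of_ball hb1 hysD (by linarith)
  have hne : zs ≠ ys := by
    intro h
    rw [h] at hzs
    have h3 := dist_triangle (D.pt 0) ys (D.pt 1)
    rw [dist_comm] at hzs
    linarith
  -- (INT_W) at the reference points, (TOP) within `min s r₀` of them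
  obtain ⟨s, hs, hint⟩ := hI D D' hsub h0 h1 ⟨ε, hε, hb0, hb1⟩ φ hφ A hA Φ hΦ zs ys hzsD' hysD'
    hne (η / 3) (by positivity)
  have htop := hT D zs ys hzsD hysD (min s r₀) (lt_min hs hr₀)
  refine ⟨r₀, hr₀, fun r hr => ?_⟩
  have hδ : ∀ᶠ δ in 𝓝[>] (0 : ℝ), δ ∈ Set.Ioo (0 : ℝ) r₀ := Ioo_mem_nhdsGT hr₀
  filter_upwards [hbhp, hint, htop, hδ] with δ hB' hI' hT' hδr z y hz1 hz2 hy1 hy2 hpos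
  obtain ⟨u, v, hu, hv, huv⟩ := hT'
  -- distances of the four lattice points to the marked points / reference points
  have hus : dist (meshPoint δ u) zs < s := lt_of_lt_of_le hu (min_le_left _ _)
  have hvs : dist (meshPoint δ v) ys < s := lt_of_lt_of_le hv (min_le_left _ _)
  have hua : dist (meshPoint δ u) (D.pt 0) < r' := by
    have h3 := dist_triangle (meshPoint δ u) zs (D.pt 0)
    have hu' : dist (meshPoint δ u) zs < r₀ := lt_of_lt_of_le hu (min_le_right _ _)
    linarith
  have hvb : dist (meshPoint δ v) (D.pt 1) < r' := by
    have h3 := dist_triangle (meshPoint δ v) ys (D.pt 1)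
    have hv' : dist (meshPoint δ v) ys < r₀ := lt_of_lt_of_le hv (min_le_right _ _)
    linarith
  have hza : dist (meshPoint δ z) (D.pt 0) < r' := by linarith [hr.2, hδr.2]
  have hyb : dist (meshPoint δ y) (D.pt 1) < r' := by linarith [hr.2, hδr.2]
  -- the three `η/3` estimates
  have e1 := hB' z u y v hza hua hyb hvb hpos huv
  have e2 := hI' u v hus hvs huv
  have e3 := hcont zs hzsD ys hysD (by linarith) (by linarith)
  -- two triangle inequalities
  have t1 := abs_sub_le
    (greenEntry (SimpleGraph.fromRel fun x y => (discreteDomainGraph D.carrier δ).Adj x y ∧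
        (meshGraph D'.carrier δ).Adj x y ∧ x ∈ meshVertices D'.carrier δ ∧
        y ∈ meshVertices D'.carrier δ) (meshDomainFinset D.carrier δ) z y /
      greenEntry (discreteDomainGraph D.carrier δ) (meshDomainFinset D.carrier δ) z y)
    (greenEntry (SimpleGraph.fromRel fun x y => (discreteDomainGraph D.carrier δ).Adj x y ∧
        (meshGraph D'.carrier δ).Adj x y ∧ x ∈ meshVertices D'.carrier δ ∧
        y ∈ meshVertices D'.carrier δ) (meshDomainFinset D.carrier δ) u v /
      greenEntry (discreteDomainGraph D.carrier δ) (meshDomainFinset D.carrier δ) u v) d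
  have t2 := abs_sub_le
    (greenEntry (SimpleGraph.fromRel fun x y => (discreteDomainGraph D.carrier δ).Adj x y ∧
        (meshGraph D'.carrier δ).Adj x y ∧ x ∈ meshVertices D'.carrier δ ∧
        y ∈ meshVertices D'.carrier δ) (meshDomainFinset D.carrier δ) u v /
      greenEntry (discreteDomainGraph D.carrier δ) (meshDomainFinset D.carrier δ) u v)
    (Real.log (‖Φ (φ.symm zs) - (starRingEnd ℂ) (Φ (φ.symm ys))‖ / ‖Φ (φ.symm zs) - Φ (φ.symm ys)‖) /
      Real.log (‖φ.symm zs - (starRingEnd ℂ) (φ.symm ys)‖ / ‖φ.symm zs - φ.symm ys‖)) d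
  linarith

/-- **REDUCTION (closing theorem of this file): `(BHP_W) → (INT_W) → AnchorExcursion`.** The item
follows from the two printed lattice inputs in their window-graph form (the lattice topology input
(TOP) being discharged by the sibling line's landed `stub_latticeTopology`) — (BHP_W): vanishing
oscillation of `G_W/G_{D_δ}` over `B(a,r) × B(b,r)` as `r → 0`, uniformly in small `δ` (uniform
discrete boundary Harnack principle at the two marked prime ends, Chelkak–Wan 2021 Lemma 3.7 /
Cor. 3.8); (INT_W): `G_W(u,v)/G_{D_δ}(u,v) → G_{D'}(z*,y*)/G_D(z*,y*)` at interior reference points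
(interior convergence of killed-SRW Green's functions, ibid. Cor. 3.3, Chelkak–Smirnov 2011, and
conformal invariance). Everything else — the lattice identity `Z(D_δ|·; 1, 1/4) = G`, the two-sided
exit decomposition, the lattice topology of Jordan domains, the continuum limit
`G_{ℍ∖A}(u,v)/G_ℍ(u,v) → Φ'_A(0)`, boundary correspondence — is in the tree. Neither hypothesis is;
both are shared verbatim in shape with stub S3b of crux 10649 (confined graph in place of `W`).
[cite: ChelkakWan2021, Lemma 3.7 and Corollary 3.8 (§3.2); Corollary 3.3 (§3.1)] -/
theorem anchorExcursion_of_oscillation_of_interiorLimit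
    (hB : ∀ (D D' : DobrushinDomain), D'.carrier ⊆ D.carrier → D'.pt 0 = D.pt 0 → D'.pt 1 = D.pt 1 →
      (∃ ε : ℝ, 0 < ε ∧ D'.carrier ∩ Metric.ball (D.pt 0) ε = D.carrier ∩ Metric.ball (D.pt 0) ε ∧
        D'.carrier ∩ Metric.ball (D.pt 1) ε = D.carrier ∩ Metric.ball (D.pt 1) ε) →
      ∀ η : ℝ, 0 < η → ∃ r : ℝ, 0 < r ∧ ∀ᶠ δ in 𝓝[>] (0 : ℝ), ∀ z z' y y' : Site 2,
        dist (meshPoint δ z) (D.pt 0) < r → dist (meshPoint δ z') (D.pt 0) < r →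
        dist (meshPoint δ y) (D.pt 1) < r → dist (meshPoint δ y') (D.pt 1) < r →
        0 < greenEntry (discreteDomainGraph D.carrier δ) (meshDomainFinset D.carrier δ) z y →
        0 < greenEntry (discreteDomainGraph D.carrier δ) (meshDomainFinset D.carrier δ) z' y' →
        |greenEntry (SimpleGraph.fromRel fun x y => (discreteDomainGraph D.carrier δ).Adj x y ∧
                (meshGraph D'.carrier δ).Adj x y ∧ x ∈ meshVertices D'.carrier δ ∧
                y ∈ meshVertices D'.carrier δ) (meshDomainFinset D.carrier δ) z y /
              greenEntry (discreteDomainGraph D.carrier δ) (meshDomainFinset D.carrier δ) z y -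
            greenEntry (SimpleGraph.fromRel fun x y => (discreteDomainGraph D.carrier δ).Adj x y ∧
                (meshGraph D'.carrier δ).Adj x y ∧ x ∈ meshVertices D'.carrier δ ∧
                y ∈ meshVertices D'.carrier δ) (meshDomainFinset D.carrier δ) z' y' /
              greenEntry (discreteDomainGraph D.carrier δ) (meshDomainFinset D.carrier δ) z' y'| ≤ η)
    (hI : ∀ (D D' : DobrushinDomain), D'.carrier ⊆ D.carrier → D'.pt 0 = D.pt 0 → D'.pt 1 = D.pt 1 →
      (∃ ε : ℝ, 0 < ε ∧ D'.carrier ∩ Metric.ball (D.pt 0) ε = D.carrier ∩ Metric.ball (D.pt 0) ε ∧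
        D'.carrier ∩ Metric.ball (D.pt 1) ε = D.carrier ∩ Metric.ball (D.pt 1) ε) →
      ∀ (φ : ConformalEquiv UpperHalfPlane.upperHalfPlaneSet D.carrier), D.IsChordalUniformizing φ →
      ∀ (A : Set ℂ), A = closure (UpperHalfPlane.upperHalfPlaneSet \
        {z | z ∈ UpperHalfPlane.upperHalfPlaneSet ∧ φ z ∈ D'.carrier}) →
      ∀ (Φ : ConformalEquiv (UpperHalfPlane.upperHalfPlaneSet \ A) UpperHalfPlane.upperHalfPlaneSet),
        IsRestrictionMap A Φ →
      ∀ zs ys : ℂ, zs ∈ D'.carrier → ys ∈ D'.carrier → zs ≠ ys →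
      ∀ η : ℝ, 0 < η → ∃ s : ℝ, 0 < s ∧ ∀ᶠ δ in 𝓝[>] (0 : ℝ), ∀ u v : Site 2,
        dist (meshPoint δ u) zs < s → dist (meshPoint δ v) ys < s →
        0 < greenEntry (discreteDomainGraph D.carrier δ) (meshDomainFinset D.carrier δ) u v →
        |greenEntry (SimpleGraph.fromRel fun x y => (discreteDomainGraph D.carrier δ).Adj x y ∧
                (meshGraph D'.carrier δ).Adj x y ∧ x ∈ meshVertices D'.carrier δ ∧
                y ∈ meshVertices D'.carrier δ) (meshDomainFinset D.carrier δ) u v /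
              greenEntry (discreteDomainGraph D.carrier δ) (meshDomainFinset D.carrier δ) u v -
            Real.log (‖Φ (φ.symm zs) - (starRingEnd ℂ) (Φ (φ.symm ys))‖ / ‖Φ (φ.symm zs) - Φ (φ.symm ys)‖) /
              Real.log (‖φ.symm zs - (starRingEnd ℂ) (φ.symm ys)‖ / ‖φ.symm zs - φ.symm ys‖)| ≤ η) :
    AnchorExcursion :=
  anchorExcursion_of_windowSphereRatioLimit
    (windowSphereRatioLimit_of_oscillation_of_interiorLimit stub_latticeTopology hB hI)

end Assembly

end Summit.CriticalPhenomena.SAWScalingLimit.Theorems.AnchorExcursion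

end
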